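import Mathlib
import HarnessLib
import Summits.CriticalPhenomena.PercolationContinuityZ3.Theorems.PercTreeValueTetrahedronHarrisGapStubNoiseWindowExpansion
import Summits.CriticalPhenomena.PercolationContinuityZ3.Theorems.PercTreeValueTetrahedronHarrisGapStubNoiseWindowOneBit
import Literature.Probability.Percolation.InfiniteClusterDensity
import Literature.Probability.Percolation.CriticalContinuityProofs
import Literature.Probability.Percolation.PercolationProofs
import Literature.Probability.Percolation.RussoFormula

/-!
# `stub_noiseWindow` (D) of line `noise_bridges` (crux `TetrahedronHarrisGap`, stmt-CriticalPhenomena-7799):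
# the exact noise-derivative formula, integrated over a window

Lead prover-line-stmt-CriticalPhenomena-7799-c3-0 (cycle 2; the ALT line `noise_bridges` is strategist s3's, its stubs registered by stub-add).
With `P = P_{p_c}` on `ℤ³`, `A = {0↔a_r}`, `B = {b_r↔c_r}`, the window `W = armEdges (2r) 0`, the mask `M ∼ P_t`, the copy `ω'`,
`ω_t = resample (M ∩ W) (ω, ω')`, `φ(t) = (P⊗P⊗P_t){ω ∈ A, ω_t ∈ B}` and `C(s) = Σ_{e∈W} (P⊗P⊗P_s){e ∈ Piv_A(ω), e ∈ Piv_B(ω_s)}`: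

* `hasDerivAt_maskSum` — derivative of the mask polynomial `Σ_{S⊆W} (∏ w_S) c(S)`: product rule + the pairing `S ↔ S ∪ f`;
* `maskSum_eq_of_insert_invariant` — if the coefficient ignores the bit `f`, the mask sum over `W` collapses to the one over `W ∖ f`;
* `stub_noiseWindow` (registered): `φ = ` the mask polynomial of `g(S) = (P⊗P){ω∈A, resample S ∈ B}` (expansion over the mask,
  `measureReal_triple_setOf_obs`), `C(s) =` the collapsed mask sum of the co-pivotal coefficients (pairing, `isPivotal_resample_insert_iff`),
  `φ' = −p_c(1−p_c)·C` (one-bit covariance `twoReplica_sub_insert_eq`), `φ(0) = P(A∩B)`; hence `C ≥ m` on `[0,t]` gives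
  `p_c(1−p_c)·t·m ≤ P(A∩B) − φ(t)` by the fundamental theorem of calculus (`intervalIntegral.integral_eq_sub_of_hasDerivAt`).
  [Radhakrishnan–Tassion arXiv:2410.23250 Prop. 1; Kalai–Keller–Mossel arXiv:1511.04600]
-/

noncomputable section

namespace Summit.CriticalPhenomena.PercolationContinuityZ3.Theorems.TetrahedronHarrisGap

open MeasureTheory
open Literature.Probability.Percolation Literature.Probability.LatticeModels

variable {V : Type*}

/-! ### Mask weights with instance decidability -/

/-- The tree's `real_setOf_obs_eq_prod` (landed with classical decidability in its statement) restated with the `if` decided by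
`DecidableEq V`, so that it rewrites inside sums written in `classical` proofs on concrete vertex types. -/
theorem real_setOf_obs_eq_prod_dec [DecidableEq V] (G : SimpleGraph V) (t : unitInterval) {W S : Finset (Sym2 V)}
    (hW : (↑W : Set (Sym2 V)) ⊆ G.edgeSet) (hS : S ⊆ W) :
    (bondPercolation G t).real {M : BondConfig V | obs M W = S} =
      ∏ i ∈ W, (if i ∈ S then (t : ℝ) else 1 - (t : ℝ)) := by
  rw [real_setOf_obs_eq_prod G t hW hS]
  exact Finset.prod_congr rfl fun i _ => by by_cases h : i ∈ S <;> simp [h]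

/-! ### The mask polynomial: derivative and pairing -/

section MaskPoly

variable [DecidableEq V]

omit [DecidableEq V] in
/-- Russo's one-coordinate weight with every coordinate active is the mask weight. -/
theorem weight_univ_eq (S : Set (Sym2 V)) (i : Sym2 V) (u : ℝ) [Decidable (i ∈ S)] :
    Russo.weight (Set.univ : Set (Sym2 V)) S i u = if i ∈ S then u else 1 - u := by
  unfold Russo.weight
  simp only [Set.mem_univ, if_true]

/-- **Derivative of the mask polynomial** `Φ(u) = Σ_{S ⊆ W} (∏_{i∈W} w_S(i,u)) c(S)`, `w_S(i,u) = u` if `i ∈ S` else `1 − u`: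
`Φ'(u) = Σ_{f ∈ W} Σ_{S ⊆ W ∖ f} (∏_{i ∈ W∖f} w_S(i,u)) (c(S ∪ f) − c(S))` (product rule, then the pairing `S ↔ insert f S`). -/
theorem hasDerivAt_maskSum (W : Finset (Sym2 V)) (c : Finset (Sym2 V) → ℝ) (u : ℝ) :
    HasDerivAt (fun u : ℝ => ∑ S ∈ W.powerset, (∏ i ∈ W, (if i ∈ S then u else 1 - u)) * c S)
      (∑ f ∈ W, ∑ S ∈ (W.erase f).powerset,
        (∏ i ∈ W.erase f, (if i ∈ S then u else 1 - u)) * (c (insert f S) - c S)) u := by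
  classical
  -- rewrite the weights as Russo weights and differentiate term by term
  have hfun : (fun u : ℝ => ∑ S ∈ W.powerset, (∏ i ∈ W, (if i ∈ S then u else 1 - u)) * c S) =
      fun u => ∑ S ∈ W.powerset, (∏ i ∈ W, Russo.weight (Set.univ : Set (Sym2 V)) ↑S i u) * c S := by
    funext u
    refine Finset.sum_congr rfl fun S _ => ?_
    congr 1
    refine Finset.prod_congr rfl fun i _ => ?_
    rw [weight_univ_eq]
    simp only [Finset.mem_coe]
  rw [hfun]
  have hderiv : HasDerivAt (fun u => ∑ S ∈ W.powerset, (∏ i ∈ W, Russo.weight (Set.univ : Set (Sym2 V)) ↑S i u) * c S)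
      (∑ S ∈ W.powerset, (∑ e ∈ W, (∏ j ∈ W.erase e, Russo.weight (Set.univ : Set (Sym2 V)) ↑S j u) *
        Russo.dweight (Set.univ : Set (Sym2 V)) ↑S e) * c S) u := by
    refine HasDerivAt.fun_sum fun S _ => ?_
    have := HasDerivAt.fun_finsetProd (u := W) (x := u)
      (fun i _ => Russo.hasDerivAt_weight (Set.univ : Set (Sym2 V)) (↑S : Set (Sym2 V)) i u)
    simpa [smul_eq_mul] using this.mul_const (c S)
  refine hderiv.congr_deriv ?_
  -- exchange the sums and pair `S ↔ insert e S`
  rw [Finset.sum_congr rfl fun S _ => Finset.sum_mul _ _ _, Finset.sum_comm]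
  refine Finset.sum_congr rfl fun e he => ?_
  have hpow : W.powerset = (W.erase e).powerset ∪ (W.erase e).powerset.image (insert e) := by
    rw [← Finset.powerset_insert, Finset.insert_erase he]
  have hdisj : Disjoint (W.erase e).powerset ((W.erase e).powerset.image (insert e)) := by
    rw [Finset.disjoint_left]
    intro S hS hS'
    obtain ⟨T, -, rfl⟩ := Finset.mem_image.1 hS'
    have := Finset.mem_powerset.1 hS (Finset.mem_insert_self e T)
    simp at this
  have hinj : Set.InjOn (insert e) (↑(W.erase e).powerset : Set (Finset (Sym2 V))) := by
    intro S hS T hT hST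
    have heS : e ∉ S := fun h => by simpa using Finset.mem_powerset.1 hS h
    have heT : e ∉ T := fun h => by simpa using Finset.mem_powerset.1 hT h
    rw [← Finset.erase_insert heS, ← Finset.erase_insert heT, hST]
  rw [hpow, Finset.sum_union hdisj, Finset.sum_image hinj, ← Finset.sum_add_distrib]
  refine Finset.sum_congr rfl fun S hS => ?_
  have heS : e ∉ S := fun h => by simpa using Finset.mem_powerset.1 hS h
  have heS' : e ∉ (↑S : Set (Sym2 V)) := by simpa using heS
  have hdS : Russo.dweight (Set.univ : Set (Sym2 V)) (↑S : Set (Sym2 V)) e = -1 := by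
    simp [Russo.dweight, heS']
  have hdiS : Russo.dweight (Set.univ : Set (Sym2 V)) (↑(insert e S) : Set (Sym2 V)) e = 1 := by
    simp [Russo.dweight]
  have hwi : ∏ j ∈ W.erase e, Russo.weight (Set.univ : Set (Sym2 V)) (↑(insert e S) : Set (Sym2 V)) j u =
      ∏ j ∈ W.erase e, Russo.weight (Set.univ : Set (Sym2 V)) (↑S : Set (Sym2 V)) j u := by
    refine Finset.prod_congr rfl fun j hj => ?_
    rw [Finset.coe_insert]
    exact Russo.weight_insert_of_ne _ _ (Finset.ne_of_mem_erase hj) _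
  have hw : ∏ j ∈ W.erase e, Russo.weight (Set.univ : Set (Sym2 V)) (↑S : Set (Sym2 V)) j u =
      ∏ i ∈ W.erase e, (if i ∈ S then u else 1 - u) := by
    refine Finset.prod_congr rfl fun i _ => ?_
    rw [weight_univ_eq]
    simp only [Finset.mem_coe]
  rw [hdS, hdiS, hwi, hw]
  ring

omit [DecidableEq V] in
/-- Splitting the window weight at `f ∈ W`: for `S ⊆ W ∖ f`,
`∏_{i∈W} w_S(i,u) = (1−u) ∏_{i∈W∖f} w_S(i,u)` and `∏_{i∈W} w_{S∪f}(i,u) = u ∏_{i∈W∖f} w_S(i,u)`. -/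
theorem prod_weight_split [DecidableEq V] {W : Finset (Sym2 V)} {f : Sym2 V} (hf : f ∈ W) {S : Finset (Sym2 V)}
    (hS : S ⊆ W.erase f) (u : ℝ) :
    (∏ i ∈ W, (if i ∈ S then u else 1 - u)) = (1 - u) * ∏ i ∈ W.erase f, (if i ∈ S then u else 1 - u) ∧
    (∏ i ∈ W, (if i ∈ insert f S then u else 1 - u)) = u * ∏ i ∈ W.erase f, (if i ∈ S then u else 1 - u) := by
  have hfS : f ∉ S := fun h => by simpa using hS h
  constructor
  · rw [← Finset.mul_prod_erase W _ hf]
    simp [hfS]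
  · rw [← Finset.mul_prod_erase W _ hf]
    simp only [Finset.mem_insert, true_or, if_true]
    congr 1
    refine Finset.prod_congr rfl fun i hi => ?_
    have hif : i ≠ f := Finset.ne_of_mem_erase hi
    simp [hif]

/-- **Pairing** `S ↔ S ∪ f`: if the coefficient does not read the bit `f ∈ W`, the mask sum over `W` collapses to the mask
sum over `W ∖ f` (the weights of `S` and `S ∪ f` add up to the weight of `S` in `W ∖ f`). -/
theorem maskSum_eq_of_insert_invariant (W : Finset (Sym2 V)) {f : Sym2 V} (hf : f ∈ W) (κ : Finset (Sym2 V) → ℝ)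
    (hκ : ∀ S ⊆ W.erase f, κ (insert f S) = κ S) (u : ℝ) :
    ∑ S ∈ W.powerset, (∏ i ∈ W, (if i ∈ S then u else 1 - u)) * κ S =
      ∑ S ∈ (W.erase f).powerset, (∏ i ∈ W.erase f, (if i ∈ S then u else 1 - u)) * κ S := by
  classical
  have hpow : W.powerset = (W.erase f).powerset ∪ (W.erase f).powerset.image (insert f) := by
    rw [← Finset.powerset_insert, Finset.insert_erase hf]
  have hdisj : Disjoint (W.erase f).powerset ((W.erase f).powerset.image (insert f)) := by
    rw [Finset.disjoint_left]
    intro S hS hS'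
    obtain ⟨T, -, rfl⟩ := Finset.mem_image.1 hS'
    have := Finset.mem_powerset.1 hS (Finset.mem_insert_self f T)
    simp at this
  have hinj : Set.InjOn (insert f) (↑(W.erase f).powerset : Set (Finset (Sym2 V))) := by
    intro S hS T hT hST
    have heS : f ∉ S := fun h => by simpa using Finset.mem_powerset.1 hS h
    have heT : f ∉ T := fun h => by simpa using Finset.mem_powerset.1 hT h
    rw [← Finset.erase_insert heS, ← Finset.erase_insert heT, hST]
  rw [hpow, Finset.sum_union hdisj, Finset.sum_image hinj, ← Finset.sum_add_distrib]
  refine Finset.sum_congr rfl fun S hS => ?_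
  have hS' : S ⊆ W.erase f := Finset.mem_powerset.1 hS
  obtain ⟨h1, h2⟩ := prod_weight_split hf hS' u
  rw [h1, h2, hκ S hS']
  ring

end MaskPoly

/-! ### The window formula (`stub_noiseWindow`) -/

/-- **stub_noiseWindow (D)** of line `noise_bridges` (strategist s3): the exact noise-derivative formula integrated over a window.
With `φ(t) = (P⊗P⊗P_t){ω ∈ A, ω_t ∈ B}` and the co-pivotal count `C(s) = Σ_{e∈W} (P⊗P⊗P_s){e ∈ Piv_A(ω), e ∈ Piv_B(ω_s)}`:
`φ` is the mask polynomial of the two-replica coefficients `g(S) = (P⊗P){ω ∈ A, resample S ∈ B}` (expansion over the mask), its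
derivative is `−p_c(1−p_c) C` (one-bit covariance + pairing), `φ(0) = P(A ∩ B)`, so `C ≥ m` on `[0,t]` gives
`p_c(1−p_c)·t·m ≤ P(A∩B) − φ(t)` by the fundamental theorem of calculus.  [Radhakrishnan–Tassion arXiv:2410.23250 Prop. 1;
Kalai–Keller–Mossel arXiv:1511.04600] -/
theorem stub_noiseWindow :
    ∃ κ : ℝ, 0 < κ ∧ ∀ (r : ℕ) (t : unitInterval) (m : ℝ),
      (∀ s : unitInterval, s ≤ t → m ≤
        ∑ e ∈ armEdges (2 * r) (0 : Site 3), ((bondPercolation (zdGraph 3) (criticalProbI 3)).prod ((bondPercolation (zdGraph 3) (criticalProbI 3)).prod (bondPercolation (zdGraph 3) s))).real {x : BondConfig (Site 3) × (BondConfig (Site 3) × BondConfig (Site 3)) | IsPivotal (openConn (0 : Site 3) ![(r : ℤ), (r : ℤ), 0]) e x.1 ∧ IsPivotal (openConn ![(r : ℤ), 0, (r : ℤ)] ![0, (r : ℤ), (r : ℤ)]) e (resample (x.2.2 ∩ (↑(armEdges (2 * r) (0 : Site 3)) : Set (Sym2 (Site 3)))) (x.1, x.2.1))}) →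
      κ * (t : ℝ) * m ≤
        (bondPercolation (zdGraph 3) (criticalProbI 3)).real (openConn 0 ![(r : ℤ), (r : ℤ), 0] ∩ openConn ![(r : ℤ), 0, (r : ℤ)] ![0, (r : ℤ), (r : ℤ)]) -
        ((bondPercolation (zdGraph 3) (criticalProbI 3)).prod ((bondPercolation (zdGraph 3) (criticalProbI 3)).prod (bondPercolation (zdGraph 3) t))).real {x : BondConfig (Site 3) × (BondConfig (Site 3) × BondConfig (Site 3)) | x.1 ∈ openConn (0 : Site 3) ![(r : ℤ), (r : ℤ), 0] ∧ resample (x.2.2 ∩ (↑(armEdges (2 * r) (0 : Site 3)) : Set (Sym2 (Site 3)))) (x.1, x.2.1) ∈ openConn ![(r : ℤ), 0, (r : ℤ)] ![0, (r : ℤ), (r : ℤ)]} := by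
  classical
  -- `κ = p_c (1 - p_c) > 0`
  set pc : ℝ := (criticalProbI 3 : ℝ) with hpc
  have hpc0 : 0 < pc := by rw [hpc, coe_criticalProbI]; exact criticalProb_zd_pos 3 (by norm_num)
  have hpc1 : pc < 1 := by rw [hpc, coe_criticalProbI]; exact criticalProb_zd_lt_one (by norm_num)
  refine ⟨pc * (1 - pc), mul_pos hpc0 (by linarith), fun r t m hC => ?_⟩
  -- the objects
  set P := bondPercolation (zdGraph 3) (criticalProbI 3) with hP
  set A : Set (BondConfig (Site 3)) := openConn (0 : Site 3) ![(r : ℤ), (r : ℤ), 0] with hA_def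
  set B : Set (BondConfig (Site 3)) := openConn (![(r : ℤ), 0, (r : ℤ)] : Site 3) ![0, (r : ℤ), (r : ℤ)] with hB_def
  set W : Finset (Sym2 (Site 3)) := armEdges (2 * r) (0 : Site 3) with hW_def
  have hW : (↑W : Set (Sym2 (Site 3))) ⊆ (zdGraph 3).edgeSet := armEdges_subset_edgeSet _ _
  have hAm : MeasurableSet A := measurableSet_openConn_holds _ _
  have hBm : MeasurableSet B := measurableSet_openConn_holds _ _
  have hAu : IsUpperSet A := isUpperSet_openConn _ _
  have hBu : IsUpperSet B := isUpperSet_openConn _ _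
  -- the two-replica coefficients
  set g : Finset (Sym2 (Site 3)) → ℝ := fun S =>
    (P.prod P).real {y : BondConfig (Site 3) × BondConfig (Site 3) | y.1 ∈ A ∧ resample (↑S : Set (Sym2 (Site 3))) y ∈ B}
    with hg
  set k : Sym2 (Site 3) → Finset (Sym2 (Site 3)) → ℝ := fun f S =>
    (P.prod P).real {y : BondConfig (Site 3) × BondConfig (Site 3) |
      IsPivotal A f y.1 ∧ IsPivotal B f (resample (↑S : Set (Sym2 (Site 3))) y)} with hk
  set Φ : ℝ → ℝ := fun u => ∑ S ∈ W.powerset, (∏ i ∈ W, (if i ∈ S then u else 1 - u)) * g S with hΦ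
  set Cp : ℝ → ℝ := fun u => ∑ f ∈ W, ∑ S ∈ (W.erase f).powerset,
    (∏ i ∈ W.erase f, (if i ∈ S then u else 1 - u)) * k f S with hCp
  -- measurability of the two-replica events
  have hDm : ∀ S : Finset (Sym2 (Site 3)), MeasurableSet
      {y : BondConfig (Site 3) × BondConfig (Site 3) | y.1 ∈ A ∧ resample (↑S : Set (Sym2 (Site 3))) y ∈ B} :=
    fun S => (measurable_fst hAm).inter (measurable_resample _ hBm)
  have hDm' : ∀ (f : Sym2 (Site 3)) (S : Finset (Sym2 (Site 3))), MeasurableSet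
      {y : BondConfig (Site 3) × BondConfig (Site 3) |
        IsPivotal A f y.1 ∧ IsPivotal B f (resample (↑S : Set (Sym2 (Site 3))) y)} := fun f S =>
    (measurable_fst (measurableSet_setOf_isPivotal' hAm f)).inter
      (measurable_resample _ (measurableSet_setOf_isPivotal' hBm f))
  -- (A) `φ(t) = Φ(t)` for every noise level in `[0,1]`
  have hresample : ∀ (M : BondConfig (Site 3)) (y : BondConfig (Site 3) × BondConfig (Site 3)),
      resample (M ∩ (↑W : Set (Sym2 (Site 3)))) y = resample (↑(obs M W) : Set (Sym2 (Site 3))) y := by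
    intro M y
    rw [coe_obs]
  have hφ : ∀ s : unitInterval,
      (P.prod (P.prod (bondPercolation (zdGraph 3) s))).real
        {x : BondConfig (Site 3) × (BondConfig (Site 3) × BondConfig (Site 3)) |
          x.1 ∈ A ∧ resample (x.2.2 ∩ (↑W : Set (Sym2 (Site 3)))) (x.1, x.2.1) ∈ B} = Φ s := by
    intro s
    have hset : {x : BondConfig (Site 3) × (BondConfig (Site 3) × BondConfig (Site 3)) |
        x.1 ∈ A ∧ resample (x.2.2 ∩ (↑W : Set (Sym2 (Site 3)))) (x.1, x.2.1) ∈ B} =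
        {x | (x.1, x.2.1) ∈ (fun S : Finset (Sym2 (Site 3)) =>
          {y : BondConfig (Site 3) × BondConfig (Site 3) | y.1 ∈ A ∧ resample (↑S : Set (Sym2 (Site 3))) y ∈ B})
            (obs x.2.2 W)} := by
      ext x
      simp only [Set.mem_setOf_eq, hresample]
    rw [hset, measureReal_triple_setOf_obs (zdGraph 3) (criticalProbI 3) s W _ hDm]
    refine Finset.sum_congr rfl fun S hS => ?_
    rw [real_setOf_obs_eq_prod_dec (zdGraph 3) s hW (Finset.mem_powerset.1 hS)]
  -- (B) `C(s) = Cp(s)` for every noise level in `[0,1]`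
  have hCeq : ∀ s : unitInterval,
      (∑ e ∈ W, (P.prod (P.prod (bondPercolation (zdGraph 3) s))).real
        {x : BondConfig (Site 3) × (BondConfig (Site 3) × BondConfig (Site 3)) |
          IsPivotal A e x.1 ∧ IsPivotal B e (resample (x.2.2 ∩ (↑W : Set (Sym2 (Site 3)))) (x.1, x.2.1))}) = Cp s := by
    intro s
    refine Finset.sum_congr rfl fun e he => ?_
    have hset : {x : BondConfig (Site 3) × (BondConfig (Site 3) × BondConfig (Site 3)) |
          IsPivotal A e x.1 ∧ IsPivotal B e (resample (x.2.2 ∩ (↑W : Set (Sym2 (Site 3)))) (x.1, x.2.1))} =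
        {x | (x.1, x.2.1) ∈ (fun S : Finset (Sym2 (Site 3)) =>
          {y : BondConfig (Site 3) × BondConfig (Site 3) |
            IsPivotal A e y.1 ∧ IsPivotal B e (resample (↑S : Set (Sym2 (Site 3))) y)}) (obs x.2.2 W)} := by
      ext x
      simp only [Set.mem_setOf_eq, hresample]
    rw [hset, measureReal_triple_setOf_obs (zdGraph 3) (criticalProbI 3) s W _ (hDm' e)]
    have hkinv : ∀ S ⊆ W.erase e, k e (insert e S) = k e S := by
      intro S _
      simp only [hk]
      congr 1
      ext y
      simp only [Set.mem_setOf_eq, isPivotal_resample_insert_iff]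
    refine Eq.trans ?_ (maskSum_eq_of_insert_invariant W he (k e) hkinv s)
    refine Finset.sum_congr rfl fun S hS => ?_
    rw [real_setOf_obs_eq_prod_dec (zdGraph 3) s hW (Finset.mem_powerset.1 hS)]
  -- (C) `Φ' = -κ Cp`
  have hderiv : ∀ u : ℝ, HasDerivAt Φ (-(pc * (1 - pc)) * Cp u) u := by
    intro u
    have hd := hasDerivAt_maskSum W g u
    refine hd.congr_deriv ?_
    simp only [hCp, Finset.mul_sum]
    refine Finset.sum_congr rfl fun f hf => Finset.sum_congr rfl fun S hS => ?_
    have hfS : f ∉ S := fun h => by simpa using Finset.mem_powerset.1 hS h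
    have hfE : f ∈ (zdGraph 3).edgeSet := hW (Finset.mem_coe.2 hf)
    have h1 := twoReplica_sub_insert_eq (zdGraph 3) (criticalProbI 3) f hfE hAu hBu hAm hBm S hfS
    simp only [hg, hk] at h1 ⊢
    have : (P.prod P).real {y | y.1 ∈ A ∧ resample (↑(insert f S)) y ∈ B} -
        (P.prod P).real {y | y.1 ∈ A ∧ resample (↑S) y ∈ B} =
        -(pc * (1 - pc)) * (P.prod P).real {y | IsPivotal A f y.1 ∧ IsPivotal B f (resample (↑S) y)} := by
      rw [hpc]; linarith
    rw [this]
    ring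
  -- continuity of `Cp` (a polynomial): via the derivative of each mask sum
  have hCpc : Continuous Cp := by
    have : ∀ f ∈ W, Continuous fun u : ℝ => ∑ S ∈ (W.erase f).powerset,
        (∏ i ∈ W.erase f, (if i ∈ S then u else 1 - u)) * k f S := fun f _ =>
      continuous_iff_continuousAt.2 fun u => (hasDerivAt_maskSum (W.erase f) (k f) u).continuousAt
    simpa only [hCp] using continuous_finsetSum W this
  -- (D) the fundamental theorem of calculus on `[0, t]`
  have ht0 : (0 : ℝ) ≤ t := t.2.1
  have ht1 : (t : ℝ) ≤ 1 := t.2.2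
  have hFTC : ∫ u in (0 : ℝ)..t, (-(pc * (1 - pc)) * Cp u) = Φ t - Φ 0 :=
    intervalIntegral.integral_eq_sub_of_hasDerivAt (fun u _ => hderiv u)
      ((continuous_const.mul hCpc).intervalIntegrable _ _)
  -- (E) the window bound `Cp ≥ m` on `[0, t]`
  have hbound : ∀ u ∈ Set.Icc (0 : ℝ) t, m ≤ Cp u := by
    intro u hu
    have hu1 : u ≤ 1 := hu.2.trans ht1
    let sI : unitInterval := ⟨u, hu.1, hu1⟩
    have hle : sI ≤ t := hu.2
    have := hC sI hle
    rw [hCeq sI] at this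
    exact this
  have hint_ge : (t : ℝ) * m ≤ ∫ u in (0 : ℝ)..t, Cp u := by
    have h1 : ∫ _ in (0 : ℝ)..t, m = (t : ℝ) * m := by
      rw [intervalIntegral.integral_const, smul_eq_mul, sub_zero]
    rw [← h1]
    exact intervalIntegral.integral_mono_on ht0 intervalIntegrable_const (hCpc.intervalIntegrable _ _) hbound
  -- (F) `Φ 0 = P(A ∩ B)`
  have hΦ0 : Φ 0 = P.real (A ∩ B) := by
    simp only [hΦ]
    rw [Finset.sum_eq_single_of_mem ∅ (Finset.empty_mem_powerset W)]
    · have hprod : ∏ i ∈ W, (if i ∈ (∅ : Finset (Sym2 (Site 3))) then (0 : ℝ) else 1 - 0) = 1 := by simp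
      rw [hprod, one_mul]
      simp only [hg, Finset.coe_empty, resample_empty]
      have : {y : BondConfig (Site 3) × BondConfig (Site 3) | y.1 ∈ A ∧ y.1 ∈ B} = (A ∩ B) ×ˢ Set.univ := by
        ext y; simp [Set.mem_prod]
      rw [this, measureReal_prod_prod, probReal_univ, mul_one]
    · intro S hS hne
      obtain ⟨i, hi⟩ := Finset.nonempty_iff_ne_empty.2 hne
      have hiW : i ∈ W := Finset.mem_powerset.1 hS hi
      rw [Finset.prod_eq_zero hiW (by simp [hi]), zero_mul]
  -- assemble
  have hκint : ∫ u in (0 : ℝ)..t, (-(pc * (1 - pc)) * Cp u) = -(pc * (1 - pc)) * ∫ u in (0 : ℝ)..t, Cp u :=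
    intervalIntegral.integral_const_mul _ _
  rw [hφ t, ← hΦ0]
  have hκ0 : 0 ≤ pc * (1 - pc) := le_of_lt (mul_pos hpc0 (by linarith))
  nlinarith [hFTC, hκint, hint_ge, hκ0, mul_le_mul_of_nonneg_left hint_ge hκ0]


end Summit.CriticalPhenomena.PercolationContinuityZ3.Theorems.TetrahedronHarrisGap

end
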